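/-
Copyright (c) 2026 the pub-hodgecm-mathlib formalisation cell (harness21).  Prover seat hodgecm-mathlib-K2E1-p16 (g0), Track B ∕ K2-LIT, h413 = `stmt-HodgeConjecture-24833`,
line `K2_E1_TraceFormulaBeta`, route of record `HCCMUnconditional`; dealer K2E1-plan (g7) (272)∕(285): G6-inst FILE 5 of ROADCARD 5Res AMENDMENT #3 «GENERAL (U,τ) LADDER» — the LEVEL
twin of ★ p860788 `…M1CMTwoComplete`: ★ p861081 `…LevelCMTwoSquare` with the MATRIX FUNCTIONAL EQUATION DISCHARGED (★ p860995 on K2-defs1's symmetric convolution data ★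
`exists_chi_convData_level_cm_two_symm`) — the (d)-realness road for the whole scattering matrix of a self-dual unitary `χ` at a `c_G`-stable finite-index level modulo `hdec`, the
K-pairing adjointness (KA), the non-vanishing letter `hMne`, and G7's level letters.
-/
import Summits.HodgeConjecture.HodgeConjecture.Theorems.K2E1ChiScatteringRealPolesLevelCMTwoFinal               -- ★ p861004 (this seat): level `L²(K_max)` trivia; brings ★ p860981 `…_matrix`, ★ p860918 G4 export, ★ `idelicBracket_pos`
import Summits.HodgeConjecture.HodgeConjecture.Theorems.K2E1ChiScatteringConjSymmetryLevelCMTwoFinal           -- ★ p860912 (K2E1-p13): brings ★ `matrix_conj_of_real_of_poleSet`, ★ `exists_real_basis_chiSectionSpace_cm`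
import Summits.HodgeConjecture.HodgeConjecture.Theorems.K2E1ChiScatteringMatrixAxisNoPoleU2                     -- ★ p860958 (K2E1-p15 g2): `analyticAt_coord_of_re_eq_half`
import Summits.HodgeConjecture.HodgeConjecture.Theorems.K2E1ChiScatteringMatrixFunctionalEquationLevelCMTwo     -- ★ p860995 (K2E4-p10): `chi_scattering_matrix_fe_level_cm_two`
import Summits.HodgeConjecture.HodgeConjecture.Theorems.K2E1ChiConvDataLevelCMTwo                               -- ★ p860739 + ED.2 (K2-defs1): `exists_chi_convData_level_cm_two_symm`
import Summits.HodgeConjecture.HodgeConjecture.Theorems.K2E1ChiSectionBoundedOfUnitaryU2                       -- ★ p860823 (K2E1-p15): `exists_bound_of_isChiSection_of_isUnitary`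
import HarnessLib

/-!
# K2·E1 — `K2E1ChiScatteringRealPolesLevelCMTwoComplete`: `hreal` AND `hs` FOR THE WHOLE CONTINUED SCATTERING MATRIX OF A SELF-DUAL UNITARY `χ` OF `U(1,1)_{L∕L⁺}` AT A `c_G`-STABLE
# FINITE-INDEX LEVEL — SQUARE `c_G`-REAL CURRENCY, (conj) CLOSED, THE MATRIX FUNCTIONAL EQUATION PROVED, THE AXIS SOCKET CLOSED FROM (KA) — modulo `hdec`, (KA), `hMne`

Track B ∕ K2-LIT, crux h413 = `stmt-HodgeConjecture-24833`; cell `hodgecm-mathlib`, squad K2, ENGINE E1, campaign «5Res», AMENDMENT #3 rung G6 («`hreal ∧ hs` at general `(U,τ)`»; consumer: the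
self-dual block package at level in ★ `K2E1SpanOperatorMatrixLetters` ∕ ★ `K2E1ChiScatteringMatrixAxisNoPoleU2` currency).  THEOREMS ONLY (no `def`, no `instance`, no notation, no named-fact
hypothesis, no `sorry`; default heartbeats); lane `--kind proof --supports stmt-HodgeConjecture-24833 --as helper` (count-neutral).  Closes no socket.

THE MATHEMATICS ([MoeglinWaldspurger1995, II.1.7–II.1.8, IV.1.8–IV.1.11, IV.3.12 (a)]; [Langlands1976, §7]; [BernsteinLapid2019, Thm 2.3, §4–§5]).  As ★ p861081: ONE `c_G`-real basis `b` of
`V(χʷ, K′, ω) = V(χ, K′, ω)` (★ `exists_real_basis_chiSectionSpace_cm`) serving as columns AND coordinates; per column ★ p860918's package and truncated families read through the union pole set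
`P`; (conj) by Galois-twist reality (★ `matrix_conj_of_real_of_poleSet`); `hreal` by B2's χ-Maass–Selberg relation in the `L²(K_max)`-model (★ p860981 `…_matrix`); the axis by ★ p860958 §3 from
the matrix functional equation and the K-pairing adjointness.  NEW HERE: the MATRIX FUNCTIONAL EQUATION `Σ_k qc_{j₀k}(1−z)·qc_{kj}(z) = δ_{jj₀}` off `P ∪ (1 − P)` is PROVED — ★ p860995
`chi_scattering_matrix_fe_level_cm_two` (Bernstein–Lapid uniqueness on the ball `D_0`, the χ-package of each `b_k` doubling as the χʷ-package) fed with K2-defs1's SYMMETRIC convolution data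
★ `exists_chi_convData_level_cm_two_symm` (the eigenvalue symmetry `ŝ_i(1 − z) = ŝ_i(z)` from ★ K2E2-p12's Weyl symmetry, whose only input is the non-vanishing letter `hMne` of ONE section
`φ₀ ∈ V(χ, K′, ω)`), our tube coordinates `q`, global pieces `qc` and union pole set `P`, and the scalar-action clause at the basis sections.  RESULT
**`chi_scattering_real_poles_level_complete_cm_two`**: `∃ n`, a `c_G`-real basis `b`, `∃ (q, Ec, qc, P)` square with ★ p860918's clauses per column, **(conj) PROVED, (FE) PROVED**, and
«`∀ σ₀ > 1`, (K-adjointness in coordinates) → `(∀ i j, hreal_{ij}) ∧ ∃ S U′, …`» — under the sockets `hdec` (every section of the block; ★ p860970 per section modulo the arch line symbol),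
`hMne` (ONE section; K2E2-p12's ROAD (R)), and G7's `hfi ∕ hK ∕ hω`; the ONE clause letter (KA) is K2E4-p10's lineage (B1) ★ `hermitian_line_identity_cm_two` ∘ (B2) ★
`K2E1MellinTestFunctionDensityLine` → FILE 2.
SATISFIABILITY: level binders = ★ p860918's (owner K2-defs1; M1 instance `K′ = K_max`, `ω = 1`); `hfi ∕ hK ∕ hω` = ★ p860912's (owner K2E1-p13; trivial at M1); `hMne` holds at M1 by ★
p860766's scalar functional equation; no binder asks a subgroup of `G(𝔸)` to be open AND compact ((278)(A)).
HONEST LABEL: HC_CM is proved only modulo the 7 printed citations (2 remaining named inputs: hLiu418 = `stmt-HodgeConjecture-24832`, h413 = `stmt-HodgeConjecture-24833`) until rung 0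
closes; this file asserts no named fact, is conditional by construction on `hdec`, `hMne`, G7's level letters and the (KA) clause letter, and closes no socket.

## References
* [MoeglinWaldspurger1995] C. Mœglin, J.-L. Waldspurger, *Spectral decomposition and Eisenstein series* (1995), II.1.7–II.1.8, IV.1.8–IV.1.11, IV.3.12 (a).
* [Langlands1976] R. P. Langlands, *On the Functional Equations Satisfied by Eisenstein Series*, LNM 544 (1976), §7.
* [BernsteinLapid2019] J. Bernstein, E. Lapid, *On the meromorphic continuation of Eisenstein series*, J. AMS 37 (2024), Thm 2.3, §4–§5.
-/

set_option autoImplicit false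
set_option linter.dupNamespace false  -- the mandated namespace repeats the summit's segment (`HodgeConjecture.HodgeConjecture`)

noncomputable section

open MeasureTheory MeasureTheory.Measure Set NumberField IsDedekindDomain Filter Topology Metric
open scoped NNReal ENNReal ComplexConjugate InnerProductSpace
open Literature.MeasureTheory.Group Literature.NumberTheory
open Literature.NumberTheory.Automorphic Literature.NumberTheory.Automorphic.UnitaryGroup AdelicGroupData
open Literature.NumberTheory.GaloisRepresentations
open Summit.HodgeConjecture.HodgeConjecture.Cruxes.H413.K2E1BorelEisensteinU
open Summit.HodgeConjecture.HodgeConjecture.Cruxes.H413.K2E1BLBorelSpacesU2Defs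
open Summit.HodgeConjecture.HodgeConjecture.Cruxes.H413.K2E1BLBorelOperatorsU2Defs
open Summit.HodgeConjecture.HodgeConjecture.Cruxes.H413.K2E1CharacterEisensteinU2Defs
open Summit.HodgeConjecture.HodgeConjecture.Cruxes.H413.K2E1ChiSectionSpaceU2Defs
open Summit.HodgeConjecture.HodgeConjecture.Cruxes.H413.K2E1ChiScatteringRealPolesOfModelLevelCMTwo (chi_scattering_hs_of_model_level_cm_two_matrix)
open Summit.HodgeConjecture.HodgeConjecture.Cruxes.H413.K2E1ChiScatteringRealPolesLevelCMTwoFinal (ne_zero_of_coeFn_ae_eq_of_continuous linearIndependent_of_coeFn_ae_eq_of_continuous)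
open Summit.HodgeConjecture.HodgeConjecture.Cruxes.H413.K2E1ChiEisensteinFamilyExportLevelCMTwo (chiEisenstein_family_export_level_cm_two)
open Summit.HodgeConjecture.HodgeConjecture.Cruxes.H413.K2E1ChiScatteringConjSymmetryLevelCMTwo (matrix_conj_of_real_of_poleSet)
open Summit.HodgeConjecture.HodgeConjecture.Cruxes.H413.K2E1ChiSectionRealBasisU2 (exists_real_basis_chiSectionSpace_cm)
open Summit.HodgeConjecture.HodgeConjecture.Cruxes.H413.K2E1ChiScatteringMatrixAxisNoPoleU2 (analyticAt_coord_of_re_eq_half)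
open Summit.HodgeConjecture.HodgeConjecture.Cruxes.H413.K2E1ChiSectionBoundedOfUnitaryU2 (exists_bound_of_isChiSection_of_isUnitary)
open Summit.HodgeConjecture.HodgeConjecture.Cruxes.H413.K2E1ChiScatteringMatrixFunctionalEquationLevelCMTwo (chi_scattering_matrix_fe_level_cm_two)
open Summit.HodgeConjecture.HodgeConjecture.Cruxes.H413.K2E1ChiConvDataLevelCMTwo (exists_chi_convData_level_cm_two_symm)
open Summit.HodgeConjecture.HodgeConjecture.Cruxes.H413.K2E1MaassSelbergSphericalBracketsCMThree (idelicBracket_pos)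

namespace Summit.HodgeConjecture.HodgeConjecture.Cruxes.H413.K2E1ChiScatteringRealPolesLevelCMTwoComplete

variable (L : Type) [Field L] [NumberField L] [IsCMField L]
variable [MeasurableSpace (quasiSplit (↥(maximalRealSubfield L)) L (IsCMField.complexConj L) 2).Adelic] [BorelSpace (quasiSplit (↥(maximalRealSubfield L)) L (IsCMField.complexConj L) 2).Adelic]
  [MeasurableSpace (arch (↥(maximalRealSubfield L)) L (IsCMField.complexConj L) 2 ((StdForm.antidiagonal 2).over L))] [BorelSpace (arch (↥(maximalRealSubfield L)) L (IsCMField.complexConj L) 2 ((StdForm.antidiagonal 2).over L))]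
  [MeasurableSpace (finAdelic (↥(maximalRealSubfield L)) L (IsCMField.complexConj L) 2 ((StdForm.antidiagonal 2).over L))] [BorelSpace (finAdelic (↥(maximalRealSubfield L)) L (IsCMField.complexConj L) 2 ((StdForm.antidiagonal 2).over L))]
  [MeasurableSpace (AdeleRing (𝓞 L) L)ˣ] [BorelSpace (AdeleRing (𝓞 L) L)ˣ]

/-- **THE (d)-REALNESS ROAD FOR THE WHOLE SCATTERING MATRIX AT A `c_G`-STABLE FINITE-INDEX LEVEL — (conj) AND THE MATRIX FUNCTIONAL EQUATION PROVED, THE AXIS SOCKET CLOSED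
FROM (KA).**  For `χ` self-dual unitary trivial on `ℝ_{>0}`, a level `K′` with ★ p860918's binders and G7's, ONE section `φ₀ ∈ V(χ, K′, ω)` with the non-vanishing letter `hMne`, under the
socket `hdec` for every section of the block: ONE `c_G`-real basis `b` of `V(χʷ, K′, ω)` with members in `V(χ, K′, ω)`, ONE pole set `P`, per column ★ p860918's package with (E1)–(E4) and the
per-ball truncated families of the SAME `Ec_i`, the entrywise reflection symmetry PROVED, the matrix functional equation `Σ_k qc_{j₀k}(1−z)·qc_{kj}(z) = δ_{jj₀}` off `P ∪ (1 − P)` PROVED (★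
p860995 ∘ ★ `exists_chi_convData_level_cm_two_symm`), and for every `σ₀ > 1`, GIVEN the K-pairing adjointness in coordinates (Gram as `K_max`-integrals): `hreal_{ij}` for every entry and
ONE finset `S ⊂ (½, σ₀)` of real poles with ONE open `U′ ⊇ {½ ≤ Re ≤ σ₀}` on which EVERY `qc_{ij}` is holomorphic off `S`.
[cite: MoeglinWaldspurger1995, II.1.8, IV.1.8–IV.1.11, IV.3.12 (a)] [cite: Langlands1976, §7] [cite: BernsteinLapid2019, Thm 2.3, §4–§5] -/
theorem chi_scattering_real_poles_level_complete_cm_two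
    (μ : Measure (quasiSplit (↥(maximalRealSubfield L)) L (IsCMField.complexConj L) 2).automorphicQuotient) [(quasiSplit (↥(maximalRealSubfield L)) L (IsCMField.complexConj L) 2).IsAutomorphicMeasure μ]
    (νG : Measure (quasiSplit (↥(maximalRealSubfield L)) L (IsCMField.complexConj L) 2).Adelic) [νG.IsHaarMeasure] [νG.IsInvInvariant] [SFinite νG]
    (μK : Measure ↥((standardMaximalCompactGL 2 L).comap (adelicVal (↥(maximalRealSubfield L)) L (IsCMField.complexConj L) 2 ((StdForm.antidiagonal 2).over L)) : Subgroup (quasiSplit (↥(maximalRealSubfield L)) L (IsCMField.complexConj L) 2).Adelic)) [μK.IsHaarMeasure]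
    (νI : Measure (AdeleRing (𝓞 L) L)ˣ) [νI.IsHaarMeasure]
    {𝓕I : Set (AdeleRing (𝓞 L) L)ˣ} (h𝓕I : IsIdeleClassDomain L 𝓕I)
    (ν : Measure ↥(adelicUnipotent (↥(maximalRealSubfield L)) L (IsCMField.complexConj L) 2)) [ν.IsHaarMeasure] [ν.IsMulRightInvariant] [ν.IsInvInvariant]
    {𝓕 : Set ↥(adelicUnipotent (↥(maximalRealSubfield L)) L (IsCMField.complexConj L) 2)} (h𝓕N : IsFundamentalDomain ↥(rationalUnipotent (↥(maximalRealSubfield L)) L (IsCMField.complexConj L) 2) 𝓕 ν) (h𝓕1 : ν 𝓕 = 1)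
    (h𝓕c : IsCompact (closure 𝓕))
    {β : (quasiSplit (↥(maximalRealSubfield L)) L (IsCMField.complexConj L) 2).Adelic → ℝ≥0∞} (hβ : IsCoveringWeight ↥((arithmeticBorel (↥(maximalRealSubfield L)) L (IsCMField.complexConj L) 2).map (quasiSplit (↥(maximalRealSubfield L)) L (IsCMField.complexConj L) 2).arithmeticSubgroup.subtype) β)
    {μZ : Measure (borelQuotient (↥(maximalRealSubfield L)) L (IsCMField.complexConj L) 2)} [SFinite μZ]
    (hμZ : ∀ f : borelQuotient (↥(maximalRealSubfield L)) L (IsCMField.complexConj L) 2 → ℝ≥0∞, Measurable f → ∫⁻ z, f z ∂μZ = ∫⁻ g, β g * f (toBorelQuotient (↥(maximalRealSubfield L)) L (IsCMField.complexConj L) 2 g) ∂νG)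
    -- the self-dual unitary character
    {χ : HeckeCharacter L} (hχ : χ.IsUnitary) (hρ : ∀ r : ℝ≥0ˣ, χ (posRealIdele L r) = 1) (hsd : reflectChar (IsCMField.complexConj L) χ = χ)
    -- the LEVEL `(K′, ω)` (★ p860918's binders VERBATIM, owner K2-defs1): `ι(K_∞) ⊆ K′ ≤ K_max`, an open compact `U₀`-part with `ω = 1`, continuity of the sections, auxiliary Haar measures
    {K' : Subgroup (quasiSplit (↥(maximalRealSubfield L)) L (IsCMField.complexConj L) 2).Adelic} {ω : ↥K' → ℂ}
    (hK' : K' ≤ ((standardMaximalCompactGL 2 L).comap (adelicVal (↥(maximalRealSubfield L)) L (IsCMField.complexConj L) 2 ((StdForm.antidiagonal 2).over L)) : Subgroup (quasiSplit (↥(maximalRealSubfield L)) L (IsCMField.complexConj L) 2).Adelic))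
    (hKinf : ∀ k : arch (↥(maximalRealSubfield L)) L (IsCMField.complexConj L) 2 ((StdForm.antidiagonal 2).over L), adelicVal (↥(maximalRealSubfield L)) L (IsCMField.complexConj L) 2 ((StdForm.antidiagonal 2).over L) (archToAdelic (↥(maximalRealSubfield L)) L (IsCMField.complexConj L) 2 _ k) ∈ standardMaximalCompactGL 2 L →
      archToAdelic (↥(maximalRealSubfield L)) L (IsCMField.complexConj L) 2 _ k ∈ K')
    (U₀ : Subgroup (GL (Fin 2) (FiniteAdeleRing (𝓞 L) L))) (hU₀o : IsOpen (U₀ : Set (GL (Fin 2) (FiniteAdeleRing (𝓞 L) L)))) (hU₀c : IsCompact (U₀ : Set (GL (Fin 2) (FiniteAdeleRing (𝓞 L) L))))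
    (hU : ∀ b : finAdelic (↥(maximalRealSubfield L)) L (IsCMField.complexConj L) 2 ((StdForm.antidiagonal 2).over L), (b : GL (Fin 2) (FiniteAdeleRing (𝓞 L) L)) ∈ U₀ →
      ∃ hb : finAdelicToAdelic (↥(maximalRealSubfield L)) L (IsCMField.complexConj L) 2 ((StdForm.antidiagonal 2).over L) b ∈ K', ω ⟨_, hb⟩ = 1)
    (hVc : ∀ φ ∈ chiSectionSpace χ K' ω, Continuous φ)
    (μa : Measure (arch (↥(maximalRealSubfield L)) L (IsCMField.complexConj L) 2 ((StdForm.antidiagonal 2).over L))) [μa.IsHaarMeasure] [μa.IsMulRightInvariant]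
    (μf : Measure (finAdelic (↥(maximalRealSubfield L)) L (IsCMField.complexConj L) 2 ((StdForm.antidiagonal 2).over L))) [μf.IsHaarMeasure]
    -- the Galois twist `c_G` and G7's level letters (★ p860912's binders VERBATIM, owner K2E1-p13): finite index in `K_max`, `c_G(K′) ⊆ K′`, `conj ω = ω ∘ c_G`
    {cG : (quasiSplit (↥(maximalRealSubfield L)) L (IsCMField.complexConj L) 2).Adelic →* (quasiSplit (↥(maximalRealSubfield L)) L (IsCMField.complexConj L) 2).Adelic}
    (hcG : ∀ g, adelicVal (↥(maximalRealSubfield L)) L (IsCMField.complexConj L) 2 _ (cG g) =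
      Matrix.GeneralLinearGroup.map (conjAdele (↥(maximalRealSubfield L)) L (IsCMField.complexConj L)) (adelicVal (↥(maximalRealSubfield L)) L (IsCMField.complexConj L) 2 _ g))
    (hfi : (K'.subgroupOf ((standardMaximalCompactGL 2 L).comap (adelicVal (↥(maximalRealSubfield L)) L (IsCMField.complexConj L) 2 ((StdForm.antidiagonal 2).over L)) : Subgroup (quasiSplit (↥(maximalRealSubfield L)) L (IsCMField.complexConj L) 2).Adelic)).FiniteIndex)
    (hK : ∀ k : ↥K', cG (k : (quasiSplit (↥(maximalRealSubfield L)) L (IsCMField.complexConj L) 2).Adelic) ∈ K') (hω : ∀ k : ↥K', conj (ω k) = ω ⟨cG (k : (quasiSplit (↥(maximalRealSubfield L)) L (IsCMField.complexConj L) 2).Adelic), hK k⟩)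
    -- THE NON-VANISHING LETTER of ONE section of the block (K2E2-p12's self-dual Weyl-symmetry input; at M1 it is ★ p860766's scalar functional equation)
    {φ₀ : (quasiSplit (↥(maximalRealSubfield L)) L (IsCMField.complexConj L) 2).Adelic → ℂ} (hφ₀ : φ₀ ∈ chiSectionSpace χ K' ω)
    (hMne : ∃ (g : (quasiSplit (↥(maximalRealSubfield L)) L (IsCMField.complexConj L) 2).Adelic) (w₁ : ℂ), 1 < w₁.re ∧
      ∫ v : ↥(adelicUnipotent (↥(maximalRealSubfield L)) L (IsCMField.complexConj L) 2), flatSectionU φ₀ w₁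
        ((quasiSplit (↥(maximalRealSubfield L)) L (IsCMField.complexConj L) 2).toAdelic
          (weylLongU ((IsCMField.complexConj L : L ≃ₐ[↥(maximalRealSubfield L)] L) : L →+* L) (rfl : (StdForm.antidiagonal 2).over L = (StdForm.antidiagonal 2).over L)) *
          ((v : (quasiSplit (↥(maximalRealSubfield L)) L (IsCMField.complexConj L) 2).Adelic) * g)) ∂ν ≠ 0)
    -- THE SOCKET: constant-term decay of `E(f_{z′}^φ)` above every truncation level, for EVERY section `φ` of the block (level payer ★ p860970, modulo the arch line symbol)
    (hdec : ∀ φ ∈ chiSectionSpace χ K' ω, ∀ T : ℝ≥0, 1 ≤ T → ∀ z' : ℂ, 1 < z'.re → ∃ M₁ : ℝ, ∀ g : (quasiSplit (↥(maximalRealSubfield L)) L (IsCMField.complexConj L) 2).Adelic, T < borelHeight g →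
      ‖eisensteinSeriesU (flatSectionU φ z') g - borelConstantTerm ν 𝓕 (eisensteinSeriesU (flatSectionU φ z')) g‖ ≤ M₁) :
    ∃ (n : ℕ) (b : Module.Basis (Fin n) ℂ ↥(chiSectionSpace (reflectChar (IsCMField.complexConj L) χ) K' ω)),
      (∀ i g, conj ((b i : (quasiSplit (↥(maximalRealSubfield L)) L (IsCMField.complexConj L) 2).Adelic → ℂ) g) = (b i : (quasiSplit (↥(maximalRealSubfield L)) L (IsCMField.complexConj L) 2).Adelic → ℂ) (cG g)) ∧ (∀ i, (b i : (quasiSplit (↥(maximalRealSubfield L)) L (IsCMField.complexConj L) 2).Adelic → ℂ) ∈ chiSectionSpace χ K' ω) ∧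
      ∃ (q : Fin n → Fin n → ℂ → ℂ) (Ec : Fin n → ℂ → (quasiSplit (↥(maximalRealSubfield L)) L (IsCMField.complexConj L) 2).Adelic → ℂ) (qc : Fin n → Fin n → ℂ → ℂ) (P : Set ℂ),
        (∀ i j, DifferentiableOn ℂ (q i j) {z : ℂ | 1 < z.re}) ∧
        (∀ i (z : ℂ), 1 < z.re → (∑ j, q i j z • (b j : (quasiSplit (↥(maximalRealSubfield L)) L (IsCMField.complexConj L) 2).Adelic → ℂ)) = ((((ν 𝓕).toReal⁻¹ : ℝ)) : ℂ) • (fun g : (quasiSplit (↥(maximalRealSubfield L)) L (IsCMField.complexConj L) 2).Adelic => (∫ v : ↥(adelicUnipotent (↥(maximalRealSubfield L)) L (IsCMField.complexConj L) 2), flatSectionU (b i : (quasiSplit (↥(maximalRealSubfield L)) L (IsCMField.complexConj L) 2).Adelic → ℂ) z ((quasiSplit (↥(maximalRealSubfield L)) L (IsCMField.complexConj L) 2).toAdelic (weylLongU ((IsCMField.complexConj L : L ≃ₐ[↥(maximalRealSubfield L)] L) : L →+* L) (rfl : (StdForm.antidiagonal 2).over L = (StdForm.antidiagonal 2).over L))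 * ((v : (quasiSplit (↥(maximalRealSubfield L)) L (IsCMField.complexConj L) 2).Adelic) * g)) ∂ν) * (((borelHeight g : ℝ) : ℂ) ^ (z - 1)))) ∧
        (∀ i g, MeromorphicNFOn (fun z => Ec i z g) univ) ∧ (∀ i j, MeromorphicNFOn (qc i j) univ) ∧
        (∀ i (z : ℂ), 1 < z.re → Ec i z = eisensteinSeriesU (flatSectionU (b i : (quasiSplit (↥(maximalRealSubfield L)) L (IsCMField.complexConj L) 2).Adelic → ℂ) z)) ∧ (∀ i j (z : ℂ), 1 < z.re → qc i j z = q i j z) ∧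
        IsClosed P ∧ (∀ z₀ : ℂ, ∀ᶠ s in 𝓝[≠] z₀, s ∉ P) ∧ (∀ z ∈ P, z.re ≤ 1) ∧
        (∀ i g (z : ℂ), z ∉ P → AnalyticAt ℂ (fun z => Ec i z g) z) ∧ (∀ i j (z : ℂ), z ∉ P → AnalyticAt ℂ (qc i j) z) ∧
        (∀ i g, DifferentiableOn ℂ (fun z => Ec i z g) Pᶜ) ∧ (∀ i j, DifferentiableOn ℂ (qc i j) Pᶜ) ∧
        (∀ i (z : ℂ), z ∉ P → Continuous (Ec i z)) ∧
        (∀ i (m : ℕ), ∃ U : Set ℂ, IsOpen U ∧ U ⊆ Metric.ball (0 : ℂ) (m + 2) ∧ (∀ z₀ ∈ Metric.ball (0 : ℂ) (m + 2), ∀ᶠ s in 𝓝[≠] z₀, s ∈ U) ∧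
          ∃ T₀ : ℝ≥0, 1 ≤ T₀ ∧ ∃ Fam : ℂ → Lp ℂ 2 μ, DifferentiableOn ℂ Fam (U \ P) ∧
            ∀ z ∈ U \ P, ((Fam z : Lp ℂ 2 μ) : (quasiSplit (↥(maximalRealSubfield L)) L (IsCMField.complexConj L) 2).automorphicQuotient → ℂ) =ᵐ[μ] (quasiSplit (↥(maximalRealSubfield L)) L (IsCMField.complexConj L) 2).quotFun (truncation ν 𝓕 T₀ (Ec i z))) ∧
        -- (conj): the entrywise reflection symmetry, PROVED (Galois-twist reality in the real basis, on the union pole set)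
        (∀ i j (z : ℂ), z ∉ P → conj z ∉ P → qc i j (conj z) = conj (qc i j z)) ∧
        -- (FE): the MATRIX FUNCTIONAL EQUATION, PROVED (★ p860995's conclusion bytes)
        (∀ z : ℂ, z ∉ P → 1 - z ∉ P → ∀ j₀ j : Fin n, ∑ k, qc j₀ k (1 - z) * qc k j z = if j = j₀ then 1 else 0) ∧
        -- the (d)-bill: given the K-PAIRING ADJOINTNESS in coordinates (Gram as `K_max`-integrals), `hreal ∧ hs` for the matrix
        ∀ σ₀ : ℝ, 1 < σ₀ →
          (∀ z : ℂ, z ∉ P → conj z ∉ P → ∀ a b₀ : Fin n,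
            ∑ c, qc a c z * (∫ k, conj ((b b₀ : (quasiSplit (↥(maximalRealSubfield L)) L (IsCMField.complexConj L) 2).Adelic → ℂ) (k : (quasiSplit (↥(maximalRealSubfield L)) L (IsCMField.complexConj L) 2).Adelic)) * (b c : (quasiSplit (↥(maximalRealSubfield L)) L (IsCMField.complexConj L) 2).Adelic → ℂ) (k : (quasiSplit (↥(maximalRealSubfield L)) L (IsCMField.complexConj L) 2).Adelic) ∂μK) = conj (∑ c, qc b₀ c (conj z) * (∫ k, conj ((b a : (quasiSplit (↥(maximalRealSubfield L)) L (IsCMField.complexConj L) 2).Adelic → ℂ) (k : (quasiSplit (↥(maximalRealSubfield L)) L (IsCMField.complexConj L) 2).Adelic)) * (b c : (quasiSplit (↥(maximalRealSubfield L)) L (IsCMField.complexConj L) 2).Adelic → ℂ) (k : (quasiSplit (↥(maximalRealSubfield L)) L (IsCMField.complexConj L) 2).Adelic) ∂μK))) →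
          (∀ i j (z : ℂ), ¬ AnalyticAt ℂ (qc i j) z → 1 / 2 < z.re → z.re ≤ σ₀ → z.im = 0 ∧ z.re < σ₀) ∧
            ∃ (S : Finset ℝ) (U' : Set ℂ), (∀ x ∈ S, (∃ i j, ¬ AnalyticAt ℂ (qc i j) (x : ℂ)) ∧ 1 / 2 < x ∧ x < σ₀) ∧ IsOpen U' ∧ {z : ℂ | 1 / 2 ≤ z.re ∧ z.re ≤ σ₀} ⊆ U' ∧
              ∀ i j, DifferentiableOn ℂ (qc i j) (U' \ ((S.image fun x : ℝ => (x : ℂ)) : Set ℂ)) := by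
  classical
  -- `χʷ = χ` is self-dual unitary; ONE `c_G`-real basis of `V(χʷ, K′, ω)` (★ `exists_real_basis_chiSectionSpace_cm`), whose members are also sections of `V(χ, K′, ω)`
  have hc : IsCMField.complexConj L * IsCMField.complexConj L = 1 := AlgEquiv.ext fun x => IsCMField.complexConj_apply_apply L x
  have hsd' : reflectChar (IsCMField.complexConj L) (reflectChar (IsCMField.complexConj L) χ) = reflectChar (IsCMField.complexConj L) χ := by rw [hsd, hsd]
  have hχ' : (reflectChar (IsCMField.complexConj L) χ).IsUnitary := by rw [hsd]; exact hχ
  obtain ⟨n, b, hb⟩ := exists_real_basis_chiSectionSpace_cm L hcG K' hfi hK hω hsd' hχ'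
  have hVV : ∀ φ : (quasiSplit (↥(maximalRealSubfield L)) L (IsCMField.complexConj L) 2).Adelic → ℂ, φ ∈ chiSectionSpace (reflectChar (IsCMField.complexConj L) χ) K' ω → φ ∈ chiSectionSpace χ K' ω := by
    rw [hsd]
    exact fun _ h => h
  have hbVχ : ∀ i, (b i : (quasiSplit (↥(maximalRealSubfield L)) L (IsCMField.complexConj L) 2).Adelic → ℂ) ∈ chiSectionSpace χ K' ω := fun i => hVV _ (b i).2
  have hbc : ∀ i, Continuous (b i : (quasiSplit (↥(maximalRealSubfield L)) L (IsCMField.complexConj L) 2).Adelic → ℂ) := fun i => hVc _ (hbVχ i)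
  have hli : LinearIndependent ℂ (fun j => (b j : (quasiSplit (↥(maximalRealSubfield L)) L (IsCMField.complexConj L) 2).Adelic → ℂ)) := b.linearIndependent.map' (Submodule.subtype _) (Submodule.ker_subtype _)
  choose Mφ hMφ using fun i => exists_bound_of_isChiSection_of_isUnitary L 2 hχ (isChiSection_of_mem (hbVχ i)) (hbc i)
  obtain ⟨Mb, hMb⟩ := Finite.exists_le Mφ
  have hbM : ∀ j x, ‖(b j : (quasiSplit (↥(maximalRealSubfield L)) L (IsCMField.complexConj L) 2).Adelic → ℂ) x‖ ≤ Mb := fun j x => (hMφ j x).trans (hMb j)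
  -- per column `b i`: ★ p860918's package and families, coordinates along `b` itself
  have h𝓕₀ : ν 𝓕 ≠ 0 := by rw [h𝓕1]; exact one_ne_zero
  have hpk := fun i => chiEisenstein_family_export_level_cm_two L μ νG ν h𝓕N h𝓕c h𝓕₀ hβ hμZ (hbVχ i) (hbc i) (hMφ i) hK' hKinf U₀ hU₀o hU₀c hU hVc μa μf b hbc hbM
  choose q Ec qc P hq hqφ hEcNF hqNF hE1 hqcq hPc hPcd hPre hEan hqan hEdiff hqdiff hEcont hF using hpk
  -- ONE pole set: the union of the columns' (closed, co-discrete, inside `{Re ≤ 1}`); every clause is monotone in the pole set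
  have hsub : ∀ i, P i ⊆ ⋃ i, P i := fun i => Set.subset_iUnion P i
  have hUc : IsClosed (⋃ i, P i) := isClosed_iUnion_of_finite hPc
  have hUcd : ∀ z₀ : ℂ, ∀ᶠ s in 𝓝[≠] z₀, s ∉ ⋃ i, P i := fun z₀ =>
    (Filter.eventually_all.2 fun i => hPcd i z₀).mono fun s hs h => by
      obtain ⟨i, hi⟩ := Set.mem_iUnion.1 h
      exact hs i hi
  have hUre : ∀ z ∈ ⋃ i, P i, z.re ≤ 1 := fun z hz => by
    obtain ⟨i, hi⟩ := Set.mem_iUnion.1 hz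
    exact hPre i z hi
  have hqaU : ∀ i j (z : ℂ), z ∉ (⋃ i, P i) → AnalyticAt ℂ (qc i j) z := fun i j z hz => hqan i j z fun h => hz (hsub i h)
  -- (conj) DISCHARGED: Galois-twist reality in the real basis (★ `matrix_conj_of_real_of_poleSet`, `b′ := b`) on the union pole set
  have hconj : ∀ i j (z : ℂ), z ∉ (⋃ i, P i) → conj z ∉ (⋃ i, P i) → qc i j (conj z) = conj (qc i j z) :=
    matrix_conj_of_real_of_poleSet hc hcG ν ((ν 𝓕).toReal⁻¹) hb hb hli hqφ hqcq hUc hUcd hUre hqaU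
  -- (FE) DISCHARGED: ★ p860995 on the ball `D_0` with K2-defs1's SYMMETRIC convolution data (★ `exists_chi_convData_level_cm_two_symm`), our `q ∕ qc ∕ P`
  obtain ⟨C₀, hC₀⟩ := exists_bound_of_isChiSection_of_isUnitary L 2 hχ (isChiSection_of_mem hφ₀) (hVc _ hφ₀)
  obtain ⟨a, ha, I, hI, i₀, η, κ, T, ŝ, hsym, hη3, hconv5, hŝ, hact, hcov, hnc, -, hκ, hcmp, hι, -, hT, hpack⟩ :=
    exists_chi_convData_level_cm_two_symm L μ νG hβ hμZ μa μf hK' hKinf U₀ hU₀o hU₀c hU hVc ν h𝓕N h𝓕c hsd hφ₀ (hVc _ hφ₀).measurable hC₀ hMne 0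
  haveI : Fintype I := hI
  have hmFE : ∀ z : ℂ, z ∉ (⋃ i, P i) → 1 - z ∉ (⋃ i, P i) → ∀ j₀ j : Fin n, ∑ k, qc j₀ k (1 - z) * qc k j z = if j = j₀ then 1 else 0 :=
    chi_scattering_matrix_fe_level_cm_two L μ νG ν h𝓕N h𝓕c h𝓕₀ hβ hμZ 0 i₀ η ha κ T ŝ hŝ hnc (fun i => (hη3 i).1) hconv5
      hcov hκ hcmp hι hT hpack hsym hsd hbVχ hli hbc hbM q (fun k z _ hz => hqφ k z hz) (fun k i z _ x => hact i z _ (hbVχ k) x) hUc hUcd hUre hqaU hqcq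
  refine ⟨n, b, hb, hbVχ, q, Ec, qc, ⋃ i, P i, hq, hqφ, hEcNF, hqNF, hE1, hqcq, hUc, hUcd, hUre, fun i g z hz => hEan i g z fun h => hz (hsub i h), hqaU,
    fun i g => (hEdiff i g).mono (Set.compl_subset_compl.2 (hsub i)), fun i j => (hqdiff i j).mono (Set.compl_subset_compl.2 (hsub i)),
    fun i z hz => hEcont i z fun h => hz (hsub i h), fun i m => ?_, hconj, hmFE, fun σ₀ hσ₀ hKA => ?_⟩
  · obtain ⟨U, hUo', hUD, hUcd', T₀, hT₀, Fam, hFd, hFam⟩ := hF i m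
    exact ⟨U, hUo', hUD, hUcd', T₀, hT₀, Fam, hFd.mono (Set.sdiff_subset_sdiff_right (hsub i)), fun z hz => hFam z ⟨hz.1, fun h => hz.2 (hsub i h)⟩⟩
  · -- the per-ball families, skolemised over (column, ball)
    choose Uo hUoo hUoD hUocd T₀ hT₀ Fam hFd hFam using hF
    -- the `L²(K_max)` classes `v_a = [b_a|_{K_max}]` (★ p861004 §1: linearly independent, non-zero)
    haveI : CompactSpace ↥((standardMaximalCompactGL 2 L).comap (adelicVal (↥(maximalRealSubfield L)) L (IsCMField.complexConj L) 2 ((StdForm.antidiagonal 2).over L)) : Subgroup (quasiSplit (↥(maximalRealSubfield L)) L (IsCMField.complexConj L) 2).Adelic) :=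
      isCompact_iff_compactSpace.1 isCompact_comap_adelicVal_standardMaximalCompactGL
    haveI : IsFiniteMeasure μK := CompactSpace.isFiniteMeasure
    have hbKm : ∀ a, MemLp (fun k : ↥((standardMaximalCompactGL 2 L).comap (adelicVal (↥(maximalRealSubfield L)) L (IsCMField.complexConj L) 2 ((StdForm.antidiagonal 2).over L)) : Subgroup (quasiSplit (↥(maximalRealSubfield L)) L (IsCMField.complexConj L) 2).Adelic) => (b a : (quasiSplit (↥(maximalRealSubfield L)) L (IsCMField.complexConj L) 2).Adelic → ℂ) (k : (quasiSplit (↥(maximalRealSubfield L)) L (IsCMField.complexConj L) 2).Adelic)) 2 μK := fun a =>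
      MemLp.of_bound ((hbc a).comp continuous_subtype_val).aestronglyMeasurable Mb (Eventually.of_forall fun k => hbM a _)
    have hbK : ∀ a, ((((hbKm a).toLp _ : Lp ℂ 2 μK)) : _ → ℂ) =ᵐ[μK] fun k => (b a : (quasiSplit (↥(maximalRealSubfield L)) L (IsCMField.complexConj L) 2).Adelic → ℂ) (k : (quasiSplit (↥(maximalRealSubfield L)) L (IsCMField.complexConj L) 2).Adelic) := fun a => MemLp.coeFn_toLp _
    have hbK0 : ∀ a, ((hbKm a).toLp _ : Lp ℂ 2 μK) ≠ 0 := fun a =>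
      ne_zero_of_coeFn_ae_eq_of_continuous L μK (isChiSection_of_mem (b a).2) (hbc a) (fun h => b.ne_zero a (Subtype.ext h)) _ (hbK a)
    have hv : LinearIndependent ℂ (fun a => ((hbKm a).toLp _ : Lp ℂ 2 μK)) := linearIndependent_of_coeFn_ae_eq_of_continuous L μK b hbc _ hbK
    -- the Gram entries: `⟪v_x, v_y⟫ = ∫ conj(b_x)·b_y dμ_K`
    have hG : ∀ x y : Fin n, ⟪(⟨(hbKm x).toLp _, Submodule.subset_span ⟨x, rfl⟩⟩ : ↥(Submodule.span ℂ (Set.range fun a => ((hbKm a).toLp _ : Lp ℂ 2 μK)))),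
        (⟨(hbKm y).toLp _, Submodule.subset_span ⟨y, rfl⟩⟩ : ↥(Submodule.span ℂ (Set.range fun a => ((hbKm a).toLp _ : Lp ℂ 2 μK))))⟫_ℂ = ∫ k, conj ((b x : (quasiSplit (↥(maximalRealSubfield L)) L (IsCMField.complexConj L) 2).Adelic → ℂ) (k : (quasiSplit (↥(maximalRealSubfield L)) L (IsCMField.complexConj L) 2).Adelic)) * (b y : (quasiSplit (↥(maximalRealSubfield L)) L (IsCMField.complexConj L) 2).Adelic → ℂ) (k : (quasiSplit (↥(maximalRealSubfield L)) L (IsCMField.complexConj L) 2).Adelic) ∂μK := fun x y => by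
      rw [Submodule.coe_inner, MeasureTheory.L2.inner_def]
      refine integral_congr_ae ?_
      filter_upwards [hbK x, hbK y] with k hx hy
      rw [hx, hy, RCLike.inner_apply']
    -- the two matrix letters in ★ p860958's coordinate currency `m z c a := qc a c z`
    have hmNF : ∀ c a, MeromorphicNFOn (fun z => qc a c z) univ := fun c a => hqNF a c
    have hmFE' : ∀ z : ℂ, z ∉ (⋃ i, P i) → 1 - z ∉ (⋃ i, P i) → ∀ d a, ∑ c, qc c d (1 - z) * qc a c z = if d = a then 1 else 0 := fun z hz hz' d a => by
      have h := hmFE (1 - z) hz' (by rwa [sub_sub_cancel]) a d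
      rw [sub_sub_cancel] at h
      rw [← h]
      exact Finset.sum_congr rfl fun c _ => mul_comm _ _
    have hKA' : ∀ z : ℂ, z ∉ (⋃ i, P i) → conj z ∉ (⋃ i, P i) → ∀ a b₀,
        ∑ c, qc a c z * ⟪(⟨(hbKm b₀).toLp _, Submodule.subset_span ⟨b₀, rfl⟩⟩ : ↥(Submodule.span ℂ (Set.range fun a => ((hbKm a).toLp _ : Lp ℂ 2 μK)))), ⟨(hbKm c).toLp _, Submodule.subset_span ⟨c, rfl⟩⟩⟫_ℂ =
          conj (∑ c, qc b₀ c (conj z) * ⟪(⟨(hbKm a).toLp _, Submodule.subset_span ⟨a, rfl⟩⟩ : ↥(Submodule.span ℂ (Set.range fun a => ((hbKm a).toLp _ : Lp ℂ 2 μK)))), ⟨(hbKm c).toLp _, Submodule.subset_span ⟨c, rfl⟩⟩⟫_ℂ) :=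
      fun z hz hz' a b₀ => by simpa only [hG] using hKA z hz hz' a b₀
    -- THE AXIS SOCKET CLOSED (★ p860958 §3)
    have haxis : ∀ a c (z : ℂ), z.re = 1 / 2 → AnalyticAt ℂ (qc a c) z := fun a c z hz =>
      analyticAt_coord_of_re_eq_half (m := fun z c a => qc a c z) hv hUcd hmNF hmFE' hKA' hz c a
    -- ★ p860981's matrix head on the union pole set
    obtain ⟨hreal, S, U', hS, hU'o, hU's, hd⟩ := chi_scattering_hs_of_model_level_cm_two_matrix L μ νG μK νI h𝓕I ν h𝓕N h𝓕1 h𝓕c hβ hχ hρ hsd (φ := fun i => (b i : (quasiSplit (↥(maximalRealSubfield L)) L (IsCMField.complexConj L) 2).Adelic → ℂ))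
      hbc (fun i => isChiSection_of_mem (hbVχ i)) hMφ (fun j => (b j : (quasiSplit (↥(maximalRealSubfield L)) L (IsCMField.complexConj L) 2).Adelic → ℂ)) (P := fun _ => ⋃ i, P i) hqφ hqNF hE1 hqcq (fun _ => hUc) (fun _ => hUcd) hqaU
      (fun i => ((hbKm i).toLp _ : Lp ℂ 2 μK)) hbK hbK0 (fun j => ((hbKm j).toLp _ : Lp ℂ 2 μK)) hbK hv (idelicBracket_pos νI h𝓕I) Uo hUoo hUocd T₀ hT₀ Fam
      (fun i m => (hFd i m).mono (Set.sdiff_subset_sdiff_right (hsub i))) (fun i m z hz => hFam i m z ⟨hz.1, fun h => hz.2 (hsub i h)⟩)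
      (fun i m z' hz' => hdec _ (hbVχ i) (T₀ i m) (hT₀ i m) z' hz') (fun _ => hUre) hconj haxis hσ₀
    exact ⟨hreal, S, U', hS, hU'o, hU's, hd⟩

end Summit.HodgeConjecture.HodgeConjecture.Cruxes.H413.K2E1ChiScatteringRealPolesLevelCMTwoComplete

end
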